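import Literature.NumberTheory.EllipticCurves.TwoDescentOneRootCubicField
import Literature.NumberTheory.EllipticCurves.MordellWeilTheoremProofs
import Literature.NumberTheory.EllipticCurves.TwoDescentParity
import Literature.NumberTheory.EllipticCurves.KummerSelmerGroupFinite
import HarnessLib

/-!
# The one-root `2`-descent map is unramified outside `2Δ∞`: `ord_v(x(P) − θ)` is even
# (Cassels, *Lectures on Elliptic Curves*, §15, proof of the finite basis theorem; the arithmetic half, step 1)

Topic `NumberTheory/EllipticCurves`; sequel of `TwoDescentOneRoot.lean` (Cassels' map `P ↦ x(P) − θ` attached to ONE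
root `θ` of the `2`-division cubic `Ψ₂ = 4x³ + b₂x² + 2b₄x + b₆`, a homomorphism `E(L) → Lˣ/Lˣ²`, LMSST 24 §15 Lemma 1)
and the one-root counterpart of `TwoDescentParity.lean` (the SPLIT case `y² = (x − e₁)(x − e₂)(x − e₃)`, Silverman AEC
Thm. X.1.1(c)). Everything here is PROVED; no named fact, no `sorry`.

Cassels, LMSST 24, §15 (p. 44, proof of the Theorem): the image of `μ : 𝔊 → ℚ[Θ]*/(ℚ[Θ]*)²` is finite because
"`a − Θ`" is, up to squares, supported on a finite set of primes — for a prime `𝔭` of the cubic field not dividing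
`2Δ`, `ord_𝔭(a − Θ)` is even. In the split case the tree proves this by comparing `x − e₁` with `x − e₂`, `x − e₃`
(`Valuation.two_dvd_log_map_sub_of_sq_eq`); with ONE root `θ ∈ L` the two other roots are not available and the
argument runs through the complementary quadratic instead: on the curve

  `(x − θ) · g(x) = (2y + a₁x + a₃)²`, `g(x) = 4x² + (4θ + b₂)x + (4θ² + b₂θ + 2b₄)` (`mul_quadratic_eq_sq_of_equation`),

and `g(x) = 4c(θ) + (x − θ)(4x + 8θ + b₂)` with `c(θ) = Ψ₂'(θ)/4 = 3θ² + (b₂/2)θ + b₄/2` (`oneRootConst`,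
`Δ = 16 c(θ)² D(θ)`). Hence, at a valuation `v` with `θ, b₂, b₄` integral and `2`, `c(θ)` units:
if `v(x) > 1` then `v(x − θ) = v(x)` and `v(g(x)) = v(x)²`, so `3 ord x = 2 ord(2y + a₁x + a₃)` and `ord(x − θ) = ord x`
is even; if `v(x) ≤ 1` and `v(x − θ) < 1` then `v(g(x)) = v(4c(θ)) = 1`, so `ord(x − θ) = 2 ord(2y + a₁x + a₃)`.

* §1 `Valuation.two_dvd_log_map_sub_of_mul_quadratic_eq_sq` — the parity lemma for ONE `ℤᵐ⁰`-valued valuation on any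
  field (no curve: the hypothesis is the displayed relation `(x − θ) g(x) = z²`). It applies verbatim over completions,
  i.e. to local points, which is the form the Selmer condition needs.
* §2 `IsDedekindDomain.HeightOneSpectrum.exists_finite_oneRoot_unramified` — over the fraction field of a Dedekind
  domain the exceptional set `{v : v(θ) > 1 ∨ v(b₂) > 1 ∨ v(b₄) > 1 ∨ v(2) ≠ 1 ∨ v(c(θ)) ≠ 1}` is finite.
* §3 `WeierstrassCurve.Affine.Point.oneRootComponent_mem_selmerGroup` — for `W` elliptic over the fraction field `K`
  of a Dedekind domain `R` and a root `θ ∈ K` of `Ψ₂`: for EVERY `P ∈ E(K)` the one-root descent value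
  `oneRootComponent W θ P ∈ K⟮S, 2⟯` (Mathlib's `IsDedekindDomain.selmerGroup`) for any `S` containing the
  exceptional set (`O ↦ 1`; `T_θ ↦ c(θ)`, a unit outside `S`; `(x, y) ↦ x − θ` by §1).
* §4 `WeierstrassCurve.Affine.Point.casselsMap_mem_selmerGroup` — the same for the Cassels map
  `E(F) → Lˣ/Lˣ²` of a curve over a subfield `F ⊆ L` at a root `θ ∈ L` (`casselsMap = oneRootHom ∘ baseChange`).
* §5 Number fields: `exists_finset_casselsMap_mem` (the Cassels map takes finitely many values — Silverman AEC
  Prop. VIII.1.6, tree `NumberField.finite_selmerGroup`) and the **effective weak Mordell–Weil inequality of the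
  generic `2`-descent**, `pow_mordellWeilRank_le_natCard_selmerGroup`: for `E/F` elliptic over a number field with
  IRREDUCIBLE `2`-division cubic, `L = F(θ)` its cubic `2`-division field (`[L : F] = 3`, `deg minpoly θ = 3`) and `S`
  the exceptional set of §2, `2 ^ rank E(F) ≤ #L⟮S, 2⟯` (Cassels §15 Theorem with Lemmas 1–2, tree
  `pow_mordellWeilRank_le_card_of_finrank_eq_three`).

Not here: the square-norm condition `N_{L/F}(x − θ) ∈ Fˣ²` cutting `L⟮S, 2⟯` further, the local conditions at `v ∈ S`,
and any identification of the Kummer/Selmer group `Sel⁽²⁾(E/F) ⊆ H¹(F, E[2])` with a subgroup of `Lˣ/Lˣ²`.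

## References

* [Cassels1991LecturesEllipticCurves] J. W. S. Cassels, *Lectures on Elliptic Curves*, LMSST 24, CUP 1991, §15
  (pp. 42–44): the map `μ`, Lemmas 1–2, the Theorem (finite basis) and its proof (`a − Θ` supported on primes of `2Δ`).
* [SilvermanAEC2009] J. H. Silverman, *The Arithmetic of Elliptic Curves*, 2nd ed. (2009), Thm. X.1.1(c), Prop. VIII.1.5(b),
  Prop. VIII.1.6 (`K(S, 2)` finite), Exercise 10.9 (the one-root descent).

Design: the valuation idioms of `TwoDescentParity.lean` (`ord_v = WithZero.log ∘ v`, signs immaterial for parity), the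
`SqUnits`/`sqClass` currency of `TwoDescent.lean` (`SqUnits K = Kˣ ⧸ (powMonoidHom 2).range` is LITERALLY the ambient group
of Mathlib's `K⟮S, 2⟯`), membership through the tree's `IsDedekindDomain.mk_mem_selmerGroup_iff`.
-/

noncomputable section

open scoped WithZero

/-! ## §1 The parity lemma for one valuation (one root) -/

namespace Valuation

variable {L : Type*} [Field L] (v : Valuation L ℤᵐ⁰)

/-- The complementary quadratic splits off `4c(θ)`: `g(x) = 4·c(θ) + (x − θ)(4x + 8θ + B₂)` where
`g(x) = 4x² + (4θ + B₂)x + (4θ² + B₂θ + 2B₄)` and `c(θ) = 3θ² + (B₂/2)θ + B₄/2` (needs `2 ≠ 0`). [folklore] -/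
private theorem quadratic_eq_four_mul_oneRootConst_add {θ B₂ B₄ : L} (h2 : (2 : L) ≠ 0) (x : L) :
    4 * x ^ 2 + (4 * θ + B₂) * x + (4 * θ ^ 2 + B₂ * θ + 2 * B₄) =
      4 * (3 * θ ^ 2 + B₂ / 2 * θ + B₄ / 2) + (x - θ) * (4 * x + 8 * θ + B₂) := by
  have h4 : (4 : L) * (3 * θ ^ 2 + B₂ / 2 * θ + B₄ / 2) = 12 * θ ^ 2 + 2 * B₂ * θ + 2 * B₄ := by
    field_simp
    ring
  rw [h4]
  ring

/-- **Parity of `ord_v(x − θ)` from ONE root** (Cassels, LMSST 24 §15, proof of the Theorem: `a − Θ` is supported,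
modulo squares, on the primes of `2Δ`; one-root form of Silverman AEC Thm. X.1.1(c)). Let `v` be a `ℤᵐ⁰`-valued
valuation on a field `L` and `θ, B₂, B₄ ∈ L` with `v(θ), v(B₂), v(B₄) ≤ 1`, `v(2) = 1` and
`v(3θ² + (B₂/2)θ + B₄/2) = 1`. If `(x − θ)(4x² + (4θ + B₂)x + 4θ² + B₂θ + 2B₄) = z²` with `x ≠ θ`, then
`log v(x − θ)` is even. (If `v(x) > 1`: `v(x − θ) = v(x)`, `v(g(x)) = v(x)²`, so `3 ord x = 2 ord z`; if `v(x) ≤ 1`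
and `v(x − θ) < 1`: `v(g(x)) = v(4c(θ)) = 1`, so `ord(x − θ) = 2 ord z`.)
[cite: Cassels1991LecturesEllipticCurves, §15 Theorem (proof)] -/
theorem two_dvd_log_map_sub_of_mul_quadratic_eq_sq {θ B₂ B₄ x z : L}
    (hθ : v θ ≤ 1) (hB₂ : v B₂ ≤ 1) (hB₄ : v B₄ ≤ 1) (h2 : v 2 = 1)
    (hc : v (3 * θ ^ 2 + B₂ / 2 * θ + B₄ / 2) = 1) (hx : x ≠ θ)
    (hz : (x - θ) * (4 * x ^ 2 + (4 * θ + B₂) * x + (4 * θ ^ 2 + B₂ * θ + 2 * B₄)) = z ^ 2) :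
    (2 : ℤ) ∣ WithZero.log (v (x - θ)) := by
  have h20 : (2 : L) ≠ 0 := fun h => by
    rw [h, map_zero] at h2
    exact zero_ne_one h2
  have h4 : v 4 = 1 := by
    rw [show (4 : L) = 2 * 2 by norm_num, map_mul, h2, one_mul]
  have h8 : v 8 = 1 := by
    rw [show (8 : L) = 2 * 4 by norm_num, map_mul, h2, h4, one_mul]
  have hx₁ : x - θ ≠ 0 := sub_ne_zero.mpr hx
  have hv₁ : v (x - θ) ≠ 0 := (v.ne_zero_iff).mpr hx₁
  -- the two factors multiply to a square
  set g := 4 * x ^ 2 + (4 * θ + B₂) * x + (4 * θ ^ 2 + B₂ * θ + 2 * B₄) with hg_def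
  have hprod : v (x - θ) * v g = v z ^ 2 := by rw [← map_mul, hz, map_pow]
  rcases lt_or_ge 1 (v x) with hxv | hxv
  · -- `v x > 1`: `v (x - θ) = v x` and `v g = (v x)²`
    have hvx : v x ≠ 0 := ne_of_gt (lt_trans zero_lt_one hxv)
    have hsub : v (x - θ) = v x := v.map_sub_eq_of_lt_left (lt_of_le_of_lt hθ hxv)
    have hlead : v (4 * x ^ 2) = v x * v x := by rw [map_mul, h4, one_mul, map_pow, pow_two]
    have hxx : v x < v x * v x := by
      calc v x = v x * 1 := (mul_one _).symm
        _ < v x * v x := mul_lt_mul_of_pos_left hxv (lt_trans zero_lt_one hxv)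
    have hrest : v ((4 * θ + B₂) * x + (4 * θ ^ 2 + B₂ * θ + 2 * B₄)) < v (4 * x ^ 2) := by
      rw [hlead]
      refine v.map_add_lt ?_ ?_
      · rw [map_mul]
        calc v (4 * θ + B₂) * v x ≤ 1 * v x := by
              gcongr
              exact v.map_add_le (by rw [map_mul, h4, one_mul]; exact hθ) hB₂
          _ = v x := one_mul _
          _ < v x * v x := hxx
      · calc v (4 * θ ^ 2 + B₂ * θ + 2 * B₄) ≤ 1 := by
              refine v.map_add_le (v.map_add_le ?_ ?_) ?_
              · rw [map_mul, h4, one_mul, map_pow]; exact pow_le_one₀ zero_le hθ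
              · rw [map_mul]; exact mul_le_one' hB₂ hθ
              · rw [map_mul, h2, one_mul]; exact hB₄
          _ < v x := hxv
          _ < v x * v x := hxx
    have hvg : v g = v x * v x := by
      rw [hg_def, show 4 * x ^ 2 + (4 * θ + B₂) * x + (4 * θ ^ 2 + B₂ * θ + 2 * B₄) =
        4 * x ^ 2 + ((4 * θ + B₂) * x + (4 * θ ^ 2 + B₂ * θ + 2 * B₄)) by ring,
        v.map_add_eq_of_lt_left hrest, hlead]
    rw [hsub, hvg] at hprod
    -- `(v x)³ = (v z)²`: take logarithms
    have hlog := congrArg WithZero.log hprod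
    rw [WithZero.log_mul hvx (mul_ne_zero hvx hvx), WithZero.log_mul hvx hvx, WithZero.log_pow,
      nsmul_eq_mul] at hlog
    push_cast at hlog
    rw [hsub]
    exact ⟨WithZero.log (v z) - WithZero.log (v x), by linarith⟩
  · -- `v x ≤ 1`: `x - θ` is integral
    have hle : v (x - θ) ≤ 1 := v.map_sub_le hxv hθ
    rcases hle.lt_or_eq with hlt | heq
    · -- `v (x - θ) < 1` forces `v g = v (4 c(θ)) = 1`
      have h4c : v (4 * (3 * θ ^ 2 + B₂ / 2 * θ + B₄ / 2)) = 1 := by rw [map_mul, h4, hc, one_mul]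
      have hsmall : v ((x - θ) * (4 * x + 8 * θ + B₂)) < v (4 * (3 * θ ^ 2 + B₂ / 2 * θ + B₄ / 2)) := by
        rw [h4c, map_mul]
        calc v (x - θ) * v (4 * x + 8 * θ + B₂) ≤ v (x - θ) * 1 := by
              gcongr
              refine v.map_add_le (v.map_add_le ?_ ?_) hB₂
              · rw [map_mul, h4, one_mul]; exact hxv
              · rw [map_mul, h8, one_mul]; exact hθ
          _ = v (x - θ) := mul_one _
          _ < 1 := hlt
      have hvg : v g = 1 := by
        rw [hg_def, quadratic_eq_four_mul_oneRootConst_add h20 x, v.map_add_eq_of_lt_left hsmall, h4c]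
      rw [hvg, mul_one] at hprod
      have hlog := congrArg WithZero.log hprod
      rw [WithZero.log_pow, nsmul_eq_mul] at hlog
      push_cast at hlog
      exact ⟨WithZero.log (v z), by linarith⟩
    · rw [heq, WithZero.log_one]
      exact dvd_zero 2

end Valuation

/-! ## §2 The finite exceptional set of primes -/

namespace IsDedekindDomain.HeightOneSpectrum

variable {R : Type*} [CommRing R] [IsDedekindDomain R] {K : Type*} [Field K] [Algebra R K]
  [IsFractionRing R K]

/-- **The finite set `S` of bad primes for the one-root `2`-descent** (Cassels §15, proof of the Theorem: the primes
of `2Δ`; here the elementary version the parity argument uses). Over the fraction field `K` of a Dedekind domain, for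
`θ, B₂, B₄ ∈ K` with `2 ≠ 0` and `c = 3θ² + (B₂/2)θ + B₄/2 ≠ 0` there is a FINITE set `S` of primes outside of which
`θ, B₂, B₄` are integral and `2`, `c` are units. [cite: Cassels1991LecturesEllipticCurves, §15 Theorem (proof)] -/
theorem exists_finite_oneRoot_unramified {θ B₂ B₄ : K} (h2 : (2 : K) ≠ 0)
    (hc : 3 * θ ^ 2 + B₂ / 2 * θ + B₄ / 2 ≠ 0) :
    ∃ S : Set (HeightOneSpectrum R), S.Finite ∧ ∀ v ∉ S,
      v.valuation K θ ≤ 1 ∧ v.valuation K B₂ ≤ 1 ∧ v.valuation K B₄ ≤ 1 ∧ v.valuation K 2 = 1 ∧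
        v.valuation K (3 * θ ^ 2 + B₂ / 2 * θ + B₄ / 2) = 1 := by
  refine ⟨{v | 1 < v.valuation K θ} ∪ {v | 1 < v.valuation K B₂} ∪ {v | 1 < v.valuation K B₄} ∪
      {v | v.valuation K 2 ≠ 1} ∪ {v | v.valuation K (3 * θ ^ 2 + B₂ / 2 * θ + B₄ / 2) ≠ 1}, ?_, fun v hv => ?_⟩
  · exact ((((setOf_one_lt_valuation_finite θ).union (setOf_one_lt_valuation_finite B₂)).union
      (setOf_one_lt_valuation_finite B₄)).union (setOf_valuation_ne_one_finite h2)).union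
      (setOf_valuation_ne_one_finite hc)
  · simp only [Set.mem_union, Set.mem_setOf_eq, not_or, not_lt, not_not] at hv
    obtain ⟨⟨⟨⟨h1, h2'⟩, h3⟩, h4⟩, h5⟩ := hv
    exact ⟨h1, h2', h3, h4, h5⟩

end IsDedekindDomain.HeightOneSpectrum

/-! ## §3 The one-root descent map lands in `K⟮S, 2⟯` -/

open scoped Classical

namespace WeierstrassCurve.Affine

open IsDedekindDomain

variable {R : Type*} [CommRing R] [IsDedekindDomain R] {K : Type*} [Field K] [CharZero K] [Algebra R K]
  [IsFractionRing R K] {W : Affine K} [W.IsElliptic] {θ : K}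

omit [CharZero K] [W.IsElliptic] in
/-- **`x(P) − θ ∈ K⟮S, 2⟯`** (Cassels §15, proof of the Theorem; one-root form of Silverman AEC Thm. X.1.1(c)). Let `W`
be an elliptic curve over the fraction field `K` of a Dedekind domain `R`, `θ ∈ K` a root of the `2`-division cubic, and
`S` a set of primes outside of which `θ, b₂, b₄` are integral and `2`, `c(θ)` are units. Then for every point
`P = (x, y) ∈ E(K)` with `x ≠ θ`, `ord_v(x − θ)` is even at every `v ∉ S`.
[cite: Cassels1991LecturesEllipticCurves, §15 Theorem (proof)] -/
theorem two_dvd_log_valuation_sub_of_isTwoTorsionX (hθ : W.IsTwoTorsionX θ) {S : Set (HeightOneSpectrum R)}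
    (hS : ∀ v ∉ S, v.valuation K θ ≤ 1 ∧ v.valuation K W.b₂ ≤ 1 ∧ v.valuation K W.b₄ ≤ 1 ∧
      v.valuation K 2 = 1 ∧ v.valuation K (W.oneRootConst θ) = 1)
    {x y : K} (hP : W.Equation x y) (hx : x ≠ θ) (v : HeightOneSpectrum R) (hv : v ∉ S) :
    (2 : ℤ) ∣ WithZero.log (v.valuation K (x - θ)) := by
  obtain ⟨h1, h2, h3, h4, h5⟩ := hS v hv
  exact (v.valuation K).two_dvd_log_map_sub_of_mul_quadratic_eq_sq h1 h2 h3 h4 h5 hx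
    (mul_quadratic_eq_sq_of_equation hθ hP)

namespace Point

/-- **The one-root `2`-descent map lands in the Selmer group `K⟮S, 2⟯` of the field** (Cassels §15, proof of the
Theorem; Silverman AEC Thm. X.1.1(c) in the split case, tree `two_dvd_log_valuation_twoDescent`). With `W/K`, `θ`, `S`
as in `two_dvd_log_valuation_sub_of_isTwoTorsionX`, for EVERY `P ∈ E(K)` the value `oneRootComponent W θ P ∈ Kˣ/Kˣ²`
(`O ↦ 1`, `T_θ ↦ c(θ)`, `(x, y) ↦ x − θ`) lies in Mathlib's `IsDedekindDomain.selmerGroup` `K⟮S, 2⟯`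
(`ord_v ≡ 0 (mod 2)` for all `v ∉ S`). [cite: Cassels1991LecturesEllipticCurves, §15 Theorem (proof)] -/
theorem oneRootComponent_mem_selmerGroup (hθ : W.IsTwoTorsionX θ) {S : Set (HeightOneSpectrum R)}
    (hS : ∀ v ∉ S, v.valuation K θ ≤ 1 ∧ v.valuation K W.b₂ ≤ 1 ∧ v.valuation K W.b₄ ≤ 1 ∧
      v.valuation K 2 = 1 ∧ v.valuation K (W.oneRootConst θ) = 1) (P : W.Point) :
    oneRootComponent W θ P ∈ selmerGroup (R := R) (K := K) (S := S) (n := 2) := by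
  rcases P with _ | ⟨x, y, hP⟩
  · rw [← zero_def, oneRootComponent_zero]
    exact Subgroup.one_mem _
  · by_cases hx : x = θ
    · -- `T_θ ↦ c(θ)`, a unit outside `S`
      rw [oneRootComponent_some_of_eq _ hx, sqClass_of_ne_zero hθ.oneRootConst_ne_zero,
        IsDedekindDomain.mk_mem_selmerGroup_iff]
      intro v hv
      rw [Units.val_mk0, (hS v hv).2.2.2.2, WithZero.log_one]
      exact dvd_zero 2
    · -- `(x, y) ↦ x − θ`, of even order outside `S`
      rw [oneRootComponent_some_of_ne _ hx, sqClass_of_ne_zero (sub_ne_zero.mpr hx),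
        IsDedekindDomain.mk_mem_selmerGroup_iff]
      intro v hv
      rw [Units.val_mk0]
      push_cast
      exact two_dvd_log_valuation_sub_of_isTwoTorsionX hθ hS hP.left hx v hv

/-- The one-root descent HOMOMORPHISM `E(K) →+ Kˣ/Kˣ²` takes values in `K⟮S, 2⟯`: its range, read multiplicatively, is
contained in the Selmer group of the field. [cite: Cassels1991LecturesEllipticCurves, §15 Theorem (proof)] -/
theorem toMul_oneRootHom_mem_selmerGroup (hθ : W.IsTwoTorsionX θ) {S : Set (HeightOneSpectrum R)}
    (hS : ∀ v ∉ S, v.valuation K θ ≤ 1 ∧ v.valuation K W.b₂ ≤ 1 ∧ v.valuation K W.b₄ ≤ 1 ∧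
      v.valuation K 2 = 1 ∧ v.valuation K (W.oneRootConst θ) = 1) (P : W.Point) :
    Additive.toMul (oneRootHom W hθ P) ∈ selmerGroup (R := R) (K := K) (S := S) (n := 2) := by
  rw [oneRootHom_apply, toMul_ofMul]
  exact oneRootComponent_mem_selmerGroup hθ hS P

/-! ## §4 The Cassels map of a curve over a subfield lands in `L⟮S, 2⟯` -/

variable {F : Type*} [Field F] {V : WeierstrassCurve F} (L : Type*) [Field L] [CharZero L] [Algebra F L]
  [Algebra R L] [IsFractionRing R L] {ϑ : L} [(V.baseChange L).IsElliptic]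

/-- **The Cassels map `E(F) → Lˣ/Lˣ²`, `P ↦ x(P) − ϑ`, lands in `L⟮S, 2⟯`** (Cassels, LMSST 24 §15, proof of the Theorem:
"the image of `μ` is finite" because `a − Θ` is supported modulo squares on the primes of `2Δ`). Here `V/F`, `L ⊇ F` is
the fraction field of a Dedekind domain `R` (e.g. a number field with `R = 𝓞 L`), `ϑ ∈ L` a root of `Ψ₂`, and `S` a
set of primes of `R` outside of which `ϑ, b₂, b₄` are integral and `2`, `c(ϑ)` are units.
[cite: Cassels1991LecturesEllipticCurves, §15 Theorem (proof)] -/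
theorem casselsMap_mem_selmerGroup (h : (V.baseChange L).toAffine.IsTwoTorsionX ϑ)
    {S : Set (HeightOneSpectrum R)}
    (hS : ∀ v ∉ S, v.valuation L ϑ ≤ 1 ∧ v.valuation L (V.baseChange L).b₂ ≤ 1 ∧
      v.valuation L (V.baseChange L).b₄ ≤ 1 ∧ v.valuation L 2 = 1 ∧
        v.valuation L ((V.baseChange L).toAffine.oneRootConst ϑ) = 1)
    (P : V.toAffine.Point) :
    Additive.toMul (casselsMap (V := V) L h P) ∈ selmerGroup (R := R) (K := L) (S := S) (n := 2) := by
  rw [casselsMap_apply, toMul_ofMul]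
  exact oneRootComponent_mem_selmerGroup h hS _

end Point

end WeierstrassCurve.Affine

/-! ## §5 Number fields: finitely many values; the effective weak Mordell–Weil inequality -/

namespace WeierstrassCurve

open scoped NumberField
open Affine Affine.Point IsDedekindDomain

variable {F : Type*} [Field F] (V : WeierstrassCurve F) (L : Type*) [Field L] [NumberField L] [Algebra F L]
  {θ : L}

/-- Over a number field `L` the exceptional set is finite: there is a finite set `S` of finite places of `L` outside
of which `θ, b₂, b₄` are integral and `2`, `c(θ)` are units (`c(θ) ≠ 0` on an elliptic curve,
`IsTwoTorsionX.oneRootConst_ne_zero`). [cite: Cassels1991LecturesEllipticCurves, §15 Theorem (proof)] -/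
theorem exists_finite_oneRoot_unramified [(V.baseChange L).IsElliptic]
    (hθ : (V.baseChange L).toAffine.IsTwoTorsionX θ) :
    ∃ S : Set (HeightOneSpectrum (𝓞 L)), S.Finite ∧ ∀ v ∉ S,
      v.valuation L θ ≤ 1 ∧ v.valuation L (V.baseChange L).b₂ ≤ 1 ∧ v.valuation L (V.baseChange L).b₄ ≤ 1 ∧
        v.valuation L 2 = 1 ∧ v.valuation L ((V.baseChange L).toAffine.oneRootConst θ) = 1 :=
  HeightOneSpectrum.exists_finite_oneRoot_unramified two_ne_zero hθ.oneRootConst_ne_zero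

/-- **The Cassels map takes finitely many values** (Cassels §15: "`μ(𝔊)` is finite"; Silverman AEC Prop. VIII.1.6:
`L(S, 2)` is finite, tree `NumberField.finite_selmerGroup`): for `V/F`, `L ⊇ F` a number field and a root `θ ∈ L` of
`Ψ₂`, there is a finite set `T ⊆ Lˣ/Lˣ²` containing `μ(P)` for every `P ∈ E(F)`.
[cite: Cassels1991LecturesEllipticCurves, §15 Theorem (proof)] -/
theorem exists_finset_casselsMap_mem [(V.baseChange L).IsElliptic] (hθ : (V.baseChange L).toAffine.IsTwoTorsionX θ) :
    ∃ T : Finset (Additive (SqUnits L)), ∀ P : V.toAffine.Point, casselsMap (V := V) L hθ P ∈ T := by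
  obtain ⟨S, hSfin, hS⟩ := exists_finite_oneRoot_unramified V L hθ
  haveI := NumberField.finite_selmerGroup (K := L) hSfin (n := 2) two_pos
  set G := selmerGroup (R := 𝓞 L) (K := L) (S := S) (n := 2) with hG
  have hfin : (Additive.toMul ⁻¹' (G : Set (SqUnits L))).Finite :=
    (Set.toFinite (G : Set (SqUnits L))).preimage Additive.toMul.injective.injOn
  refine ⟨hfin.toFinset, fun P => ?_⟩
  rw [Set.Finite.mem_toFinset, Set.mem_preimage, SetLike.mem_coe]
  exact casselsMap_mem_selmerGroup (R := 𝓞 L) L hθ hS P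

/-- **Effective weak Mordell–Weil inequality by the generic `2`-descent** (Cassels, LMSST 24 §15, the Theorem with
Lemmas 1–2; Silverman AEC VIII.1 + X.1.1). Let `E/F` be an elliptic curve over a number field whose `2`-division cubic
is irreducible, `L = F(θ)` its cubic `2`-division field (`[L : F] = 3`, `θ` a root with `deg minpoly_F θ = 3`), and `S`
a set of finite places of `L` outside of which `θ, b₂, b₄` are integral and `2`, `c(θ) = Ψ₂'(θ)/4` are units. Then
`2 ^ rank E(F) ≤ #L⟮S, 2⟯` (`= 0` is Mathlib's junk value if `S` is infinite; for finite `S` the right side is the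
order of a finite group). Proof: `E(F)/2E(F) ↪ μ(E(F)) ⊆ L⟮S, 2⟯` (`pow_mordellWeilRank_le_card_of_finrank_eq_three`,
`casselsMap_mem_selmerGroup`). [cite: Cassels1991LecturesEllipticCurves, §15 Theorem] -/
theorem pow_mordellWeilRank_le_natCard_selmerGroup [NumberField F] [V.IsElliptic] (h3 : Module.finrank F L = 3)
    (hθ : (V.baseChange L).toAffine.IsTwoTorsionX θ) (hmin : (minpoly F θ).natDegree = 3)
    {S : Set (HeightOneSpectrum (𝓞 L))} (hSfin : S.Finite)
    (hS : ∀ v ∉ S, v.valuation L θ ≤ 1 ∧ v.valuation L (V.baseChange L).b₂ ≤ 1 ∧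
      v.valuation L (V.baseChange L).b₄ ≤ 1 ∧ v.valuation L 2 = 1 ∧
        v.valuation L ((V.baseChange L).toAffine.oneRootConst θ) = 1) :
    2 ^ V.mordellWeilRank ≤ Nat.card (selmerGroup (R := 𝓞 L) (K := L) (S := S) (n := 2)) := by
  haveI : (V.baseChange L).IsElliptic := by rw [WeierstrassCurve.baseChange]; infer_instance
  haveI : Module.Finite ℤ V.toAffine.Point := V.module_finite_point_holds
  haveI : FiniteDimensional F L := Module.finite_of_finrank_eq_succ h3
  haveI := NumberField.finite_selmerGroup (K := L) hSfin (n := 2) two_pos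
  set G := selmerGroup (R := 𝓞 L) (K := L) (S := S) (n := 2) with hG
  have hfin : (Additive.toMul ⁻¹' (G : Set (SqUnits L))).Finite :=
    (Set.toFinite (G : Set (SqUnits L))).preimage Additive.toMul.injective.injOn
  have hT : ∀ P : V.toAffine.Point, casselsMap (V := V) L hθ P ∈ hfin.toFinset := fun P => by
    rw [Set.Finite.mem_toFinset, Set.mem_preimage, SetLike.mem_coe]
    exact casselsMap_mem_selmerGroup (R := 𝓞 L) L hθ hS P
  have hle := pow_mordellWeilRank_le_card_of_finrank_eq_three V L h3 hθ hmin hfin.toFinset hT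
  have hcard : hfin.toFinset.card = Nat.card G := by
    rw [← Set.ncard_eq_toFinset_card _ hfin,
      Set.ncard_preimage_of_injective_subset_range Additive.toMul.injective
        (fun g _ => ⟨Additive.ofMul g, rfl⟩), ← Nat.card_coe_set_eq]
    rfl
  rwa [hcard] at hle

/-- **Weak Mordell–Weil through the cubic field, existence form**: for `E/F` elliptic over a number field with
irreducible `2`-division cubic and `L = F(θ)` its cubic `2`-division field, some finite set `S` of finite places of
`L` satisfies `2 ^ rank E(F) ≤ #L⟮S, 2⟯`. [cite: Cassels1991LecturesEllipticCurves, §15 Theorem] -/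
theorem exists_finite_pow_mordellWeilRank_le_natCard_selmerGroup [NumberField F] [V.IsElliptic]
    (h3 : Module.finrank F L = 3) (hθ : (V.baseChange L).toAffine.IsTwoTorsionX θ)
    (hmin : (minpoly F θ).natDegree = 3) :
    ∃ S : Set (HeightOneSpectrum (𝓞 L)), S.Finite ∧
      2 ^ V.mordellWeilRank ≤ Nat.card (selmerGroup (R := 𝓞 L) (K := L) (S := S) (n := 2)) := by
  haveI : (V.baseChange L).IsElliptic := by rw [WeierstrassCurve.baseChange]; infer_instance
  obtain ⟨S, hSfin, hS⟩ := exists_finite_oneRoot_unramified V L hθ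
  exact ⟨S, hSfin, pow_mordellWeilRank_le_natCard_selmerGroup V L h3 hθ hmin hSfin hS⟩

end WeierstrassCurve

end
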